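import Mathlib
import HarnessLib
import Summits.ResolutionOfSingularities.ResolutionOfSingularities.Theorems.WildQuotientsWildQuotientResolutionS1aInvariantNode

/-!
# W4.5c SIG — (M) MULT-GOOD: a node with a homogeneous semi-invariant of UNIT ROW is good (A-NIL v0 §3, torsor trick)

[v2: `g ∈ nonZeroDivisors B` added to every Prop — v1 (without it) over-claims at `g = 0`; OURS · L1 W4.5c · plan-1 g14 SIG file — STATEMENTS ONLY (Props), no proofs; counted 0; AI-level, weaker than expert review]
Crux stmt-ResolutionOfSingularities-17941, line `s1a-logminvertex`; CHAIN v10.30 RULING (R-N3); memo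
`Cruxes/CyclicQuotientFourfolds/Lines/s1a-logminvertex-A-NIL-v0.md` §3 (torsor trick), §3bis (J₂ example).

THE TRICK. Tame node `(B, 𝒜, σ)` at the prime `p` (regular Noetherian, graded by `ι`, `σ` graded of order `p`) with
augmentation ideal contained in `(β)` (`β` the full fixed divisor) and a HOMOGENEOUS `g` with `σ g = g * u`,
`u - 1 = β * ρ`, `u ∈ 𝒜 0`, `ρ` a UNIT («multiplicative-type row»), `g` a NON-ZERO-DIVISOR (then `u` is a unit with
`∏_{i<p} σ^i u = σ^p g / g = 1`, which is what makes `σ″` below an automorphism of order `p`; without it `g = 0` would make the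
statement claim goodness of every node). Put `B″ := B[x, x⁻¹]` (Laurent polynomials), graded by
`ℤ × ι` with `deg x = (1, 0)`, and extend `σ` by `σ″ x := x * u`. Then `σ″` is a graded automorphism of order `p`
(`σ″^p x = x * ∏ σ^i u = x * σ^p g / g = x`), and `augmentationIdeal σ″ = (β)` is PRINCIPAL
(`σ″ x - x = x * β * ρ` with `x * ρ` a unit, and every `σ″ y - y ∈ (β)`), while `(B″, 𝒜″, σ″)` is again a tame node
(`isRegularRing_laurent`; unit `x` of degree `(1,0)` for (T1); (T2) with `t ∪ {x, x⁻¹}`). Hence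
`InvariantsRegular.isTameRootChart_gradeZero_invariants` (the ℤ × Π-graded (N5)) applies to `B″`: the `σ″`-fixed part
of `𝒜″ 0 = 𝒜 0` — i.e. `(𝒜 0)^σ`, the quotient chart ring — is a TAME ROOT CHART, and `isGoodAt_of_nodeChart_invariants`
makes the model GOOD at every point of the chart. (The frameʼs kill is the case `g :=` the torsor coordinate of the last
exceptional divisor; MULT-GOOD allows ANY homogeneous semi-invariant, e.g. old exceptional coordinates or components of
the initial fixed divisor, and applies on plain charts `ι = 0`.)

Items for the typer (≤ 200 lines expected, all by REUSE of lead-1ʼs kill pipeline):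
* `MultGoodNode p` below — the ring-level statement (prove it as `theorem multGoodNode_holds : MultGoodNode p`);
* the model-level corollary is `isGoodAt_of_nodeChart_invariants` / the `IsNodeChart` bridge, verbatim as in
  `…S1aGoodOfKilledNode.isGoodAt_of_killedNode` with `(B″, 𝒜″, σ″)` reindexed to `Π j : Fin (m+1), ZMod (r′ j)`, `r′ 0 = 0`
  (`…S1aNodeReindex`).
-/

set_option linter.dupNamespace false

noncomputable section

namespace Summit.ResolutionOfSingularities.ResolutionOfSingularities.Cruxes.CyclicQuotientFourfolds.MultGoodSig

open Literature.AlgebraicGeometry.Resolution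
open Summit.ResolutionOfSingularities.ResolutionOfSingularities.Theorems.WildQuotientResolution.S1
open Summit.ResolutionOfSingularities.ResolutionOfSingularities.Theorems.WildQuotientResolution.S1.ProducerStep

universe u

/-- **(M) MULT-GOOD, ring level.** For a tame node `(B, 𝒜, σ)` at the prime `p`, bigraded by `ℤ × Π j, ZMod (r j)` (any chart
ring of the game; take the `ℤ`-part trivial for a plain chart), of finite type over a Noetherian ring `R₀` of `σ`-fixed
degree-`0` elements: if the augmentation ideal lies in `(β)` and some HOMOGENEOUS `g` has `σ g = g * u` with `u ∈ 𝒜 0`,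
`u - 1 = β * ρ` and `ρ` a unit, then the `σ`-fixed part of `𝒜 0` is a tame root chart. [OURS · L1 W4.5c · SIG] -/
def MultGoodNode (p : ℕ) : Prop :=
  ∀ {B : Type} [CommRing B] {m : ℕ} (r : Fin m → ℕ)
    (𝒜 : (ℤ × (Π j : Fin m, ZMod (r j))) → AddSubgroup B) [GradedRing 𝒜] (σ : B ≃+* B)
    (hnode : IsTameNode p B 𝒜 σ)
    {R₀ : Type} [CommRing R₀] [IsNoetherianRing R₀] [Algebra R₀ B] [Algebra.FiniteType R₀ B],
    (∀ a : R₀, σ (algebraMap R₀ B a) = algebraMap R₀ B a) → (∀ a : R₀, algebraMap R₀ B a ∈ 𝒜 0) →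
    ∀ (β g u ρ : B) (d : ℤ × (Π j : Fin m, ZMod (r j))),
      augmentationIdeal σ ≤ Ideal.span {β} →
      g ∈ nonZeroDivisors B → g ∈ 𝒜 d → u ∈ 𝒜 0 → σ g = g * u → u - 1 = β * ρ → IsUnit ρ →
      IsTameRootChart ↥(RingHom.eqLocus
        (((σ : B →+* B).comp (SetLike.GradeZero.subring 𝒜).subtype).codRestrict (SetLike.GradeZero.subring 𝒜)
          (fun x => hnode.2.2.2.2.1 0 x.1 x.2))
        (RingHom.id _))

/-- **(M′) MULT-GOOD, `Π ZMod`-graded form** (node charts of the game as consumed by `IsNodeChart` /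
`isGoodAt_of_killedNode`). [OURS · L1 W4.5c · SIG] -/
def MultGoodNodePi (p : ℕ) : Prop :=
  ∀ {B : Type} [CommRing B] {m : ℕ} (r : Fin m → ℕ)
    (𝒜 : (Π j : Fin m, ZMod (r j)) → AddSubgroup B) [GradedRing 𝒜] (σ : B ≃+* B)
    (hnode : IsTameNode p B 𝒜 σ)
    {R₀ : Type} [CommRing R₀] [IsNoetherianRing R₀] [Algebra R₀ B] [Algebra.FiniteType R₀ B],
    (∀ a : R₀, σ (algebraMap R₀ B a) = algebraMap R₀ B a) → (∀ a : R₀, algebraMap R₀ B a ∈ 𝒜 0) →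
    ∀ (β g u ρ : B) (d : Π j : Fin m, ZMod (r j)),
      augmentationIdeal σ ≤ Ideal.span {β} →
      g ∈ nonZeroDivisors B → g ∈ 𝒜 d → u ∈ 𝒜 0 → σ g = g * u → u - 1 = β * ρ → IsUnit ρ →
      IsTameRootChart ↥(RingHom.eqLocus
        (((σ : B →+* B).comp (SetLike.GradeZero.subring 𝒜).subtype).codRestrict (SetLike.GradeZero.subring 𝒜)
          (fun x => hnode.2.2.2.2.1 0 x.1 x.2))
        (RingHom.id _))

/-- **The Laurent extension is a KILLED tame node** — the one lemma behind (M)/(M′): for the data of `MultGoodNodePi`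
there are a `ℤ × Π`-grading `𝒜″` on `B[x, x⁻¹]` with `𝒜″ (n, e) = 𝒜 e · x^n` and a ring automorphism `σ″` with
`σ″ (C b) = C (σ b)`, `σ″ x = x * C u`, such that `(B[x,x⁻¹], 𝒜″, σ″)` is a tame node at `p` and
`augmentationIdeal σ″ = (C β)`. Stated as an existence Prop so that the typer may choose the encoding
(`LaurentPolynomial B` = `AddMonoidAlgebra B ℤ`). [OURS · L1 W4.5c · SIG] -/
def LaurentKilledNode (p : ℕ) : Prop :=
  ∀ {B : Type} [CommRing B] {m : ℕ} (r : Fin m → ℕ)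
    (𝒜 : (Π j : Fin m, ZMod (r j)) → AddSubgroup B) [GradedRing 𝒜] (σ : B ≃+* B),
    IsTameNode p B 𝒜 σ →
    ∀ (β g u ρ : B) (d : Π j : Fin m, ZMod (r j)),
      augmentationIdeal σ ≤ Ideal.span {β} →
      g ∈ nonZeroDivisors B → g ∈ 𝒜 d → u ∈ 𝒜 0 → σ g = g * u → u - 1 = β * ρ → IsUnit ρ →
      ∃ (𝒜'' : (ℤ × (Π j : Fin m, ZMod (r j))) → AddSubgroup (LaurentPolynomial B)) (_ : GradedRing 𝒜'')
        (σ'' : LaurentPolynomial B ≃+* LaurentPolynomial B),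
        IsTameNode p (LaurentPolynomial B) 𝒜'' σ'' ∧
        (∀ (n : ℤ) (e : Π j : Fin m, ZMod (r j)) (b : B), b ∈ 𝒜 e →
          LaurentPolynomial.C b * LaurentPolynomial.T n ∈ 𝒜'' (n, e)) ∧
        (∀ b : B, σ'' (LaurentPolynomial.C b) = LaurentPolynomial.C (σ b)) ∧
        σ'' (LaurentPolynomial.T 1) = LaurentPolynomial.T 1 * LaurentPolynomial.C u ∧
        augmentationIdeal σ'' = Ideal.span {LaurentPolynomial.C β}

end Summit.ResolutionOfSingularities.ResolutionOfSingularities.Cruxes.CyclicQuotientFourfolds.MultGoodSig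

end
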